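import Summits.QuantumFields.BalabanUV.T4Continuum.Support.ShellMeasureLandauEndAssembledDecayReachToy
import Summits.QuantumFields.BalabanUV.T4Continuum.Support.ShellMeasureLandauEndAssembledBlockP4

/-!
# `T4Continuum.ShellMeasureLandauEndAssembledReachBlockP4` — row S77 f8 (file 1): «(P4) AND THE WHOLE (T1) TUPLE LIVE IN THE
# γ3 END» — THE MOST-ASSEMBLED ONE-SLOT DECLARATION OF RECORD (S80 f6, core ∕ collar form) APPLIED WITH (T1) := THE BLOCK FIELD
# SPACE, `hW` := OUR ACTION'S (P4) BINDER, A NON-ZERO PROPAGATOR LETTER AND A NON-ZERO LANDAU-CORRECTION TRIPLE, ON leaf-03's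
# CORNER DATUM (crew REFEREE NE7c passes 22–24 §3 open item «(P4) second half … the END of record … a toy with `W𝒱 ≠ 0`»;
# t4-ref2 C-t4r2-386 caveat (ii) for the f6 lineage; this lineage's gen-10 follow-up (ii) «exercise (T1)'s Landau correction»)
(cell `pub-balaban`, sub-cell `t4`, spine estimate NE7c (node U5b); NE7c ROUND-2 crew, unit
`b2b-balaban-t4-ne7c-formalise-leaf-02` gen 11; journal INTENT l.20950; ADDITIVE — imports leaf-03-g7's S80 f7
`ShellMeasureLandauEndAssembledDecayReachToy` (corner datum + γ3 pair; through it S80 f6 `…ReachBox` p232354, S80 f4, S88, S89 f1)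
and this lineage's R10 f2 `ShellMeasureLandauEndAssembledBlockP4` (`rdL_solAt_eq_zero`; through it R10 f1 `…BlockSpace`: `𝕐`,
`𝕎`, `blockW`, `blockW_prop4Hyp`, `rdL`, `𝒢L`, `c₀`, `c₁`) ONLY, ALL BY NAME; [folklore]; data `def`s `embOf` (generic
embedding), `ampC`, `εθ₂` (this file's read-out amplitude and (SM) threshold); 0 `def … : Prop`, 0 sorry, 0 citation tags)

HONEST FRAMING.  A CONSISTENCY CERTIFICATE (rule G-1) — the TYPE-LEVEL JOINT INHABITATION of the ≈ 230-binder hypothesis list of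
the most-assembled one-slot END in its γ3 (core ∕ collar) form with the (P4) letter `hW` inhabited by OUR η-scaled cubic action's
block functional instead of `W𝒱 = 0` and NO (T1) letter set to zero; nothing about Bałaban's minimiser, propagators, kernels or
densities.  Finite four-torus programme, rung (B)+1 only — NOT infinite volume, NOT a mass gap, NOT the Clay problem, NOT summit
progress; NE7c (`T4IndicatorShell.ShellWeightBound`) NOT PRINTED, NOT PROVED; «NE7c ⇐ the named binders» (c3); (M1) realized on
a toy ≠ NE7c.  HONEST DEPENDENCY (cell): continuum YM on T⁴ ⇐ BetaPertH ∧ nine spine estimates (0/9 proved); BetaPertH ⇐ (D1) ∧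
(D4) ∧ CAP+tail; G-an2-4 gates asym, D1 and NE2/3/4.

WHY.  R10 f2 `…AssembledBlockP4.slotAC_assembled_decay_blockP4` put (T1) on the block field space with `hW := blockW_prop4Hyp` for
S80 **f3** (the END the ONE CALL of record S95 f1′ composes), with `Cf = ιs = Hop = 0`.  The most-assembled ONE-SLOT declaration
of record is S80 **f6** (R-ne7cp1-g34-4 (a)) — the γ3 form on the block's box (comb gauge `fixTo (combBonds lo hi) 1`, box data
`hn hN hΛbox hΛcomb`, located readings `hcore`∕`hcollar` + `hcover`, reach `(d−1)·nb·a ≤ 2 sin(S∕2)` IN PLACE OF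
`hFsupp`∕`ctr`∕`T`), whose Cf-twin S99 f3b the ONE CALL v2 (S102) composes; its joint-inhabitation witness (leaf-03-g7's S80 f7)
keeps `W𝒱 = 0`.  THIS FILE:
* §1 **`embOf d η c R`** — R10 f1's embedding with S88's letter replaced by ANY letter map `R : X →L[ℂ] M₂` written at the moving
  bond `c`: `rdL_embOf_c₀` (the read-out SEES bond `c₀`), `rdL_embOf_c₁` (it does NOT see bond `c₁`), `norm_embOf_le`
  (`≤ (2∕η)·K‖y‖`); **`ampC d`** `= 1∕16 + 1∕(128(C₄c d + 1))` (`ampC_bounds`); **`εθ₂ d S η`** (`εθ₂_pos`).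
* §2 **`slotAC_assembled_decay_core_collar_blockP4_lit`** ∕ **`slotAC_assembled_decay_core_collar_blockP4`**: S80 f6 APPLIED
  BY NAME on leaf-03's corner datum VERBATIM (`T := combBonds lo (lo+2)`, `Λ := {b₀}`, centre `1`, `toyU p₀`, `toyF7` with its
  KEPT co-test, `toyJco7`, `readOut7`, the γ3 pair `hcore_toy`∕`hcollar_toy` AS THEOREMS, cover `boxPlaqs ⊆ {p₀} ∪ boxPlaqs`) with
  `𝒴 := 𝕐 d η`, `𝒵 := 𝕎 d`, `𝒴′ = 𝒳 := M₂`, **`W𝒱 V := blockW d η`, `hW V := blockW_prop4Hyp`** (`C₄ := C₄c d`, `a₃ := 1∕8`),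
  **`𝒢 V := 𝒢L d η (B₀η∕2)` NON-ZERO** (B11 Prop. 6's fixed point GENUINE, fed by OUR `blockW`, invisible to the read-out —
  R10 f2 `rdL_solAt_eq_zero`), **the Landau-correction triple LIVE**: `Cf V Z := ½·Z²` (quadratic, analytic: `hCq`, `hCd`,
  `h18`, `h3R` met with `C₂ = ½`, `R_C = 1`), `ιs V := rdL` (`hι`), `Hop V := (B₀η∕2)•embOf c₁ id` (`hH`; writes the correction
  at the SECOND bond, so `rdL ∘ landauExp = rdL` — the canonical correction `corrAt` is carried but NOT seen, exactly like
  `solAt`), `H₁ V := (B₀∕E₀)•embOf c₀ readOut7`, `Φ V := (E₀∕B₀)•id` (`B₀ = 1∕(C₄c d + 1)`, `E₀ = 6∕η`, `r_Φ = η∕192`,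
  `ε₄ = 1∕32`, `ε₁ = (C₄c d + 1)∕64`, `ε₃ = 1∕16`), read-out `ℓs () := [rdL]` (`κ_r = κ_c = 1`, `m = 1`), leaf-03's dictionary
  READ THROUGH `𝕐` (`rdL (landauExp … (solAt … + H₁ (Φ (cplx x)))) = readOut7 (cplx x) = gen x`), (T2)∕(T3)∕(S78) := S80 f4's
  degenerate-but-legal data VERBATIM, the Stokes tail with the amplitude `z̄ = ampC d` (the quadratic Landau term INCLUDED):
  `c₁ := z̄∕η²`, `c₂ := z̄∕η`, `z := 1`, threshold `εθ₂ d S η` ((SM) an EQUALITY); symbolic `P`, `j` (≥ 3 sites per direction),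
  `lo`, `i₀ < i₁`, `d ≥ 2`, `0 < η ≤ 1`, `0 < S < η∕192`, `0 ≤ ρ ≤ ¼`, `0 < a`, `(P.d−1)·2·a ≤ 2 sin(S∕2)`, `εθ₂ d S η·η² ≤ a`.
  Conclusion: f6's (M1), literal (`_lit`) and clean `4·m₀`.  EVERY binder met; had some (T1) letter NOT lived on `𝕐` next to our
  `hW` AND the γ3 box∕reading family, that would have been a FINDING; none arose.  File 2 (`…ReachBlockP4Dim4`): numbers.
WHAT THIS DOES NOT DO: exercise (T2)∕(T3) (caveat (i) of C-t4r2-386 STANDS — zero kernels); COMPUTE a Landau correction or a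
minimiser (both are `Classical.epsilon` selections the read-out provably ignores); touch S99 f3b's `…_cfB7` (its u-tuple FIXES
`Cf := landauCf` on `𝔸^{Sf}` — a separate question); discharge anything of Bałaban's.  NOTHING in the countdown moves.
-/

noncomputable section

open Set Metric NormedSpace MeasureTheory Function

namespace Summit.QuantumFields.BalabanUV.T4Continuum.ShellMeasureLandauEndAssembledReachBlockP4

open scoped ENNReal Matrix.Norms.L2Operator
open Literature.MathematicalPhysics.QuantumFieldTheory.Balaban1983to89
open B11Prop6Scheme (Prop4Hyp)
open T4ShellMeasure (SlotAntiConcentration)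
open T4CubePoincare (cube mem_cube_iff)
open T4CubeChartGnomonic (SU2)
open T4AxialGaugeFixing (combBonds)
open T4AxialGaugeSmallField (boxPlaqs)
open T4ExpWindowSmallField (dist1_eq_norm_coe_sub_one)
open T4ShellMeasurePlaquette (expTail₂)
open ShellMeasureLevelAssembly (classifier)
open ShellMeasureWilsonWords (wordExp wordExp_cons wordExp_nil)
open ShellMeasureMultiGridNormsMax (WMax)
open ShellMeasureCommutatorCovDatum (covIdx unitW)
open ShellMeasurePlaquetteCubicFrozenBox (boxΛ)
open ShellMeasureLandauHolonomy (solAt landauExp corrAt)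
open ShellMeasureLandauHolonomyChart (cplx holOf holOf_apply norm_cplx_le)
open ShellMeasureLandauHolonomySkew (readOutReal)
open ShellMeasureWilsonRealizedSU2 (M₂ gen coe_chart gen_mem_skewAdjoint)
open ShellMeasureLandauEndFinalToy (toyU measurable_toyU gaugeInvariant_toyU smul_mem_cube solAt_zero landauExp_zero)
open ShellMeasureLandauEndAssembledToy (norm_kerOp_zero_le)
open ShellMeasureLandauEndAssembledDecayReachBox (slotAC_realized_su2_landauChart_assembled_decay_of_core_collar)
open ShellMeasureLevelZeroBoxWitness (side_two_side side_two_nonwrapping)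
open ShellMeasureLandauEndAssembledDecayReachToyData (b₀ p₀ readOut7 norm_readOut7_le readOut7_cplx singleton_box
  singleton_comb plaqHol_p₀_sec)
open ShellMeasureLandauEndAssembledDecayReachToy (toyF7 toyJco7 measurable_toyF7 gaugeInvariant_toyF7 toyF7_le_one
  toyF7_section_mono hcore_toy hcollar_toy datum_nonvacuous)
open ShellMeasureLandauEndBlockSpace (mv₂ c₀ c₁ c₀_ne_c₁ wY DvY 𝕐 𝕎 blockW C₄c C₄c_nonneg blockW_prop4Hyp rdL 𝒢L rdL_𝒢L
  norm_rdL_le norm_𝒢L_le norm_le_of_letters real_smul_mem_skewAdjoint)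
open ShellMeasureLandauEndAssembledBlockP4 (rdL_solAt_eq_zero)

/-! ## §1 The generic embedding of a letter map into the block field space; the amplitude and threshold of this file -/

section Emb
variable (d : ℕ)
/-- THE READ-OUT AMPLITUDE of this file's (T1) tuple: `z̄ = (ε₄ + B₀·2d_LC₁ε₁) + B₀·4C₂z̄₀² = 1∕16 + B₀∕128` with the LIVE
Landau-correction constant `C₂ = ½` (`B₀ = 1∕(C₄c d + 1)`). [folklore] -/
def ampC : ℝ := 1 / 16 + 1 / (128 * (C₄c d + 1))

/-- `1∕16 < z̄ ≤ 9∕128` (for `d ≥ 1`). [folklore] -/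
theorem ampC_bounds (hd1 : 1 ≤ d) : 1 / 16 < ampC d ∧ ampC d ≤ 9 / 128 := by
  have hC := C₄c_nonneg d hd1
  have h0 : (0 : ℝ) < 1 / (128 * (C₄c d + 1)) := by positivity
  have h : 1 / (128 * (C₄c d + 1)) ≤ (1 : ℝ) / 128 := by rw [div_le_div_iff_of_pos_left one_pos (by positivity) (by norm_num)]; linarith
  unfold ampC; constructor <;> linarith

/-- THE (SM) THRESHOLD of this file (unit currency; classifier threshold `εθ₂·η²`): (SM) with EQUALITY for the read-out data
`c₁ := z̄∕η²`, `c₂ := z̄∕η`, `z := 1`, `m = 1`, `δ = ½` at the chart radius `(η∕192)∕S` (R10 f1's `εθ₁` with `1∕16 ↦ z̄`). [folklore] -/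
def εθ₂ (S η : ℝ) : ℝ :=
  72 * (ampC d / η ^ 2 * 1 + ((1 : ℕ) : ℝ) ^ 2 * (ampC d / η) ^ 2 * 1 ^ 2) / ((η / 192) / S - 1) ^ 2

/-- `0 < εθ₂` in the window `S < η∕192`. [folklore] -/
theorem εθ₂_pos (hd1 : 1 ≤ d) {S η : ℝ} (hS : 0 < S) (hη : 0 < η) (hSη : S < η / 192) : 0 < εθ₂ d S η := by
  have h1 : 1 < (η / 192) / S := by rw [lt_div_iff₀ hS]; linarith
  have h2 : 0 < (η / 192) / S - 1 := by linarith
  have h4 : 0 < ampC d := by linarith [(ampC_bounds d hd1).1]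
  unfold εθ₂; positivity

variable [NeZero d]
/-- THE EMBEDDING into the block space through ANY letter map `R : X →L[ℂ] M₂`, the letter `R y` placed at the moving bond `c`
(zero at the other) — R10 f1's `embL` is the instance `c := c₀`, `R := toyReadOut p e`. [folklore] -/
def embOf (η : ℝ) (c : ↥(mv₂ d)) {X : Type*} [NormedAddCommGroup X] [NormedSpace ℂ X] (R : X →L[ℂ] M₂) : X →L[ℂ] 𝕐 d η :=
  ((WMax.toPiL (wY d) (unitW ↥(covIdx (boxΛ d))) (DvY d η)).symm : (↥(mv₂ d) → M₂) →L[ℂ] 𝕐 d η).comp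
    ((ContinuousLinearMap.single ℂ (fun _ : ↥(mv₂ d) => M₂) c).comp R)
variable {X : Type*} [NormedAddCommGroup X] [NormedSpace ℂ X]

/-- The read-out SEES a letter written at the first moving bond: `rdL ∘ embOf c₀ R = R`. [folklore] -/
theorem rdL_embOf_c₀ (η : ℝ) (R : X →L[ℂ] M₂) (y : X) : rdL d η (embOf d η (c₀ d) R y) = R y :=
  show (Pi.single (c₀ d) (R y) : ↥(mv₂ d) → M₂) (c₀ d) = _ by rw [Pi.single_eq_same]

/-- The read-out DOES NOT SEE a letter written at the second moving bond: `rdL ∘ embOf c₁ R = 0` (`d ≥ 2`). [folklore] -/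
theorem rdL_embOf_c₁ (h01 : (0 : Fin d) ≠ 1) (η : ℝ) (R : X →L[ℂ] M₂) (y : X) : rdL d η (embOf d η (c₁ d) R y) = 0 :=
  show (Pi.single (c₁ d) (R y) : ↥(mv₂ d) → M₂) (c₀ d) = _ by rw [Pi.single_eq_of_ne (c₀_ne_c₁ d h01)]

/-- **THE EMBEDDING IS BOUNDED BY `(2∕η)·K`** when the letter map is bounded by `K` (each letter of `Pi.single c (R y)` is
`≤ ‖R y‖`, then R10 f1 `norm_le_of_letters`). [folklore] -/
theorem norm_embOf_le {η : ℝ} (hη : 0 < η) (hη1 : η ≤ 1) (c : ↥(mv₂ d)) (R : X →L[ℂ] M₂) {K : ℝ} (hK : 0 ≤ K)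
    (hR : ∀ y, ‖R y‖ ≤ K * ‖y‖) (y : X) : ‖embOf d η c R y‖ ≤ 2 / η * (K * ‖y‖) := by
  refine norm_le_of_letters d hη hη1 (embOf d η c R y) (by positivity) fun c' => le_trans ?_ (hR y)
  show ‖(Pi.single c (R y) : ↥(mv₂ d) → M₂) c'‖ ≤ ‖R y‖
  rcases eq_or_ne c' c with rfl | h
  · rw [Pi.single_eq_same]
  · rw [Pi.single_eq_of_ne h, norm_zero]; exact norm_nonneg _

end Emb

/-! ## §2 THE MOST-ASSEMBLED ONE-SLOT END (γ3 form, S80 f6) APPLIED WITH `hW` := OUR BLOCK (P4) BINDER on leaf-03's datum -/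

section End
variable {P : Params} {j : ℕ} [DecidableEq (PBond P j)]

/-- **«(P4) AND THE WHOLE (T1) TUPLE LIVE IN THE γ3 END» (literal slot constant).**  S80 f6
`…ReachBox.slotAC_realized_su2_landauChart_assembled_decay_of_core_collar` APPLIED BY NAME on leaf-03's corner datum (S80 f7
VERBATIM) with `𝒴 := 𝕐 d η`, `𝒵 := 𝕎 d`, `𝒴′ = 𝒳 := M₂`, `W𝒱 V := blockW d η`, `hW V := blockW_prop4Hyp` (`C₄ := C₄c d`,
`a₃ := 1∕8`), `𝒢 := 𝒢L d η (B₀η∕2)`, `Cf Z := ½Z²`, `ιs := rdL`, `Hop := (B₀η∕2)•embOf c₁ id`, `H₁ := (B₀∕E₀)•embOf c₀ readOut7`,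
`Φ := (E₀∕B₀)•id`, `ℓs () := [rdL]`, (T2)∕(T3)∕(S78) S80 f4's data, threshold `εθ₂ d S η` — EVERY binder met; symbolic `P`, `j`
(≥ 3 sites per direction), `lo`, `i₀ < i₁`, `e`, `d ≥ 2`, `0 < η ≤ 1`, `0 < S < η∕192`, `0 ≤ ρ ≤ ¼`, `0 < a`,
`(P.d−1)·2·a ≤ 2 sin(S∕2)`, `εθ₂ d S η·η² ≤ a`.  A consistency certificate; nothing of Bałaban's; NE7c NOT PROVED. [folklore] -/
theorem slotAC_assembled_decay_core_collar_blockP4_lit (lo : Fin P.d → ℤ) {i₀ i₁ : Fin P.d} (h01 : i₀ < i₁)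
    (h3 : 3 ≤ P.sitesPerDir j) {m₀ : ℕ} (e : ↥({b₀ lo i₀ i₁} : Finset (PBond P j)) × Fin 3 ≃ Fin m₀)
    (d : ℕ) [NeZero d] (hd2 : 2 ≤ d) {η S ρ a : ℝ} (hη : 0 < η) (hη1 : η ≤ 1) (hS : 0 < S) (hSη : S < η / 192)
    (hρ0 : 0 ≤ ρ) (hρ4 : ρ ≤ 1 / 4) (ha : 0 < a)
    (hrad : ((P.d - 1 : ℕ) : ℝ) * (2 : ℕ) * a ≤ 2 * Real.sin (S / 2)) (hθa : εθ₂ d S η * η ^ 2 ≤ a) :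
    SlotAntiConcentration ((fieldMeasure P j SU2).withDensity (toyF7 lo h01 a)) (toyU (p₀ lo i₀ i₁ h01)) (εθ₂ d S η * η ^ 2) ρ
      (2 * ((m₀ : ℝ) + (3 * (|(0:ℝ)| * ((0 +
                2 * (1 * (0 * 1 * (1/6) / ((1 - 0 * 1 * (2 * 0 * (2/3) * Real.exp (0 * 0))) *
                    (1 - 2 * 0 * 2 * Real.exp (0 * 0) * (0 * 1) * (0 * 1)))) +
                  expTail₂ (((1:ℕ):ℝ) * (1 * (0 * 1 * (1/6) / ((1 - 0 * 1 * (2 * 0 * (2/3) * Real.exp (0 * 0))) *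
                    (1 - 2 * 0 * 2 * Real.exp (0 * 0) * (0 * 1) * (0 * 1))))))) / ((1/3) / S)) *
                (2 * (1 * (0 * 1 * (1/6) / ((1 - 0 * 1 * (2 * 0 * (2/3) * Real.exp (0 * 0))) *
                    (1 - 2 * 0 * 2 * Real.exp (0 * 0) * (0 * 1) * (0 * 1)))) +
                  expTail₂ (((1:ℕ):ℝ) * (1 * (0 * 1 * (1/6) / ((1 - 0 * 1 * (2 * 0 * (2/3) * Real.exp (0 * 0))) *
                    (1 - 2 * 0 * 2 * Real.exp (0 * 0) * (0 * 1) * (0 * 1))))))) / ((1/3) / S))) * 1) +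
              (3 * (0 * (2 * (((1/6) + 1 * (1/6)) + 1 * (4 * 0 * ((1/6) + 1 * (1/6)) ^ 2)))) / ((1/3) / S - 1) + 0))) / (1 - 1/2)) := by
  have hd1 : 1 ≤ d := by omega
  have hd01 : (0 : Fin d) ≠ 1 := by
    intro h
    have h' := congrArg Fin.val h
    rw [Fin.val_zero, Fin.val_one', Nat.mod_eq_of_lt (by omega)] at h'
    exact absurd h' (by norm_num)
  have hN := side_two_nonwrapping (j := j) h3 lo
  have hSπ : 3 * S ^ 2 < Real.pi ^ 2 := by nlinarith [Real.pi_gt_three]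
  have hC := C₄c_nonneg d hd1
  have hs0 : 0 ≤ 1 / (C₄c d + 1) * η / 2 := by positivity
  have h𝒢B : ∀ f : 𝕎 d, ‖𝒢L d η (1 / (C₄c d + 1) * η / 2) f‖ ≤ 1 / (C₄c d + 1) * ‖f‖ := fun f =>
    (norm_𝒢L_le d hη hη1 hs0 f).trans (le_of_eq (by field_simp))
  have hC1 : 0 < C₄c d + 1 := by linarith
  have hB₀ : 0 < 1 / (C₄c d + 1) := by positivity
  have hR7 : ∀ y : Fin m₀ → ℂ, ‖readOut7 lo e y‖ ≤ 3 * ‖y‖ := fun y => norm_readOut7_le lo e y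
  have hamp : (1 : ℝ) * ((1 / 32 + 1 / (C₄c d + 1) * (2 * 1 * 1 * ((C₄c d + 1) / 64))) +
      1 / (C₄c d + 1) * (4 * (1 / 2) * (1 / 32 + 1 / (C₄c d + 1) * (2 * 1 * 1 * ((C₄c d + 1) / 64))) ^ 2)) = ampC d := by
    unfold ampC; field_simp; ring
  have hamp1 := (ampC_bounds d hd1).2
  -- the Landau-correction map writes at the SECOND moving bond: the read-out never sees the correction `corrAt`
  have hHop0 : ∀ X' : M₂, rdL d η ((((1 / (C₄c d + 1) * η / 2 : ℝ) : ℂ) •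
      embOf d η (c₁ d) (ContinuousLinearMap.id ℂ M₂)) X') = 0 := fun X' => by
    rw [smul_apply, map_smul, rdL_embOf_c₁ d hd01, smul_zero]
  refine slotAC_realized_su2_landauChart_assembled_decay_of_core_collar (P := P) (j := j) (n := Fin 2)
    (𝒴 := 𝕐 d η) (𝒴' := M₂) (𝒳 := M₂) (𝒵 := 𝕎 d) (ℬ := Fin m₀ → ℂ) (ι := Unit)
    (Pu := {()}) (δ := 1 / 2) (ρ := ρ) (β := 0) (B₀ := 1 / (C₄c d + 1)) (C₄ := C₄c d) (a₃ := 1 / 8) (ε₄ := 1 / 32)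
    (dL := 1) (C₁ := 1) (B₃ := 1) (ε₁ := (C₄c d + 1) / 64) (rΦ := η / 192) (C₂ := 1 / 2) (RC := 1) (ε₃ := 1 / 16) (κr := 1)
    (m := 1) (κc := 1)
    (Λw := Unit) (Λz := Unit) (Λw' := Unit) (Λx := Unit) (Λb := Unit) (𝔖 := Unit) (𝔄w := ℂ) (ℭ := ℂ) (𝔄' := ℂ)
    (𝔅 := ℂ) (𝔇 := ℂ) (δw := 0) (c𝒢 := 0) (δ𝒢 := 0) (M𝒢 := 1) (cι := 0) (δι := 0) (Mι := 1) (cH := 0) (δH := 0)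
    (MH := 1) (cH₁ := 0) (δH₁ := 0) (MH₁ := 1) (B₀w := 1) (C₄w := 0) (a₃w := 2 / 3) (ε₄w := 1 / 6) (bw := 1 / 6)
    (rΦw := 1 / 3) (C₂w := 0) (RCw := 2) (rW := 0) (rC := 0) (𝔭 := Unit) (κwb := 1) (κcb := 1) (mw := 1)
    (d := fun _ => 0) (dbar := 0) (Kw := 1) (Λe := Unit) (𝔄 := ℂ) (δ' := 0) (ϖ := fun _ => 0) (𝒴e' := ℂ) (𝒳e := ℂ)
    (𝒵e := ℂ) (ℬe := ℂ) (B₀e := 1) (C₄e := 0) (a₃e := 2 / 3) (be := 1 / 6) (ε₄e := 1 / 6) (rΦe := 1 / 3) (C₂e := 0)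
    (RCe := 1) (𝔱 := Unit) (Ef := fun _ _ => 0) (rE := 1) (ee := fun _ => 0) (LK := 0) (BE₁ := 0) (Ω := Unit)
    (g := fun _ => 1) (Bd := 0) (BE₂ := 0) (η := η) (εθ := εθ₂ d S η) (c₁ := ampC d / η ^ 2) (c₂ := ampC d / η) (z := 1)
    (a := a) (Pcore := ({p₀ lo i₀ i₁ h01} : Set (Plaq P j))) (Pcollar := boxPlaqs lo (fun κ => lo κ + 2)) (side_two_side lo)
    hN {b₀ lo i₀ i₁} (singleton_box hN h01) (singleton_comb hN h01) e hS hSπ (measurable_toyF7 lo h01 a)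
    (gaugeInvariant_toyF7 lo h01 a) (measurable_toyU (p₀ lo i₀ i₁ h01)) (gaugeInvariant_toyU (p₀ lo i₀ i₁ h01))
    (Finset.singleton_nonempty ()) (fun _ => cube m₀ S) (toyJco7 lo h01 e S a)
    (fun _ => 𝒢L d η (1 / (C₄c d + 1) * η / 2)) (fun _ => blockW d η) (fun _ f => h𝒢B f)
    (fun _ => blockW_prop4Hyp d hd1 hη hη1) hB₀ hC (by norm_num)
    zero_le_one zero_le_one (by positivity) le_rfl ?_ (by norm_num) ?_
    (fun _ => (((1 / (C₄c d + 1)) / (6 / η) : ℝ) : ℂ) • embOf d η (c₀ d) (readOut7 lo e)) ?_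
    (fun _ z => (((6 / η) / (1 / (C₄c d + 1)) : ℝ) : ℂ) • z)
    (fun _ => ((((((6 / η) / (1 / (C₄c d + 1)) : ℝ) : ℂ) •
        ContinuousLinearMap.id ℂ (Fin m₀ → ℂ)).differentiable.differentiableOn).congr fun z _ => rfl))
    (fun _ => smul_zero _) ?_ hSη
    (fun _ Z => (1 / 2 : ℂ) • (Z * Z)) (by norm_num) ?_
    (fun _ => ((differentiable_id.mul differentiable_id).const_smul (1 / 2 : ℂ)).differentiableOn)
    (fun _ => rdL d η) (fun _ Y => norm_rdL_le d η Y)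
    (fun _ => (((1 / (C₄c d + 1) * η / 2 : ℝ) : ℂ) • embOf d η (c₁ d) (ContinuousLinearMap.id ℂ M₂))) ?_ ?_ ?_ (by norm_num)
    (fun _ => [rdL d η]) zero_le_one
    (fun _ _ ℓ hℓ Y => by rw [List.mem_singleton.1 hℓ, one_mul]; exact norm_rdL_le d η Y)
    (fun _ _ => by simp) zero_le_one
    (fun _ _ Y => by simpa using norm_rdL_le d η Y)
    le_rfl (fun _ => 0) (fun _ _ => 0)
    (fun _ _ => by simp) id id id id id (fun _ _ _ => 0) (fun _ _ _ => 0) (fun _ _ _ => 0) (fun _ _ _ => 0) le_rfl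
    zero_le_one (fun _ _ _ => by simp) (fun _ => by simp) le_rfl zero_le_one (fun _ _ _ => by simp)
    (fun _ => by simp) le_rfl zero_le_one (fun _ _ _ => by simp) (fun _ => by simp) le_rfl zero_le_one
    (fun _ _ _ => by simp) (fun _ => by simp) (fun _ _ => 0) (fun _ f => norm_kerOp_zero_le zero_le_one f)
    (fun _ => ⟨fun Y _ => by simp, differentiableOn_const _⟩) one_pos le_rfl (by norm_num) (by norm_num)
    (by norm_num) (by norm_num) (fun _ B => norm_kerOp_zero_le zero_le_one B) (fun _ _ => 0)
    (fun _ => differentiableOn_const _) (fun _ => rfl) (fun _ z _ => by simp) (by linarith) (fun _ _ => 0) le_rfl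
    (fun _ Z _ => by simp) (fun _ => differentiableOn_const _)
    (fun _ Y => by simpa using norm_kerOp_zero_le zero_le_one Y) (fun _ X => norm_kerOp_zero_le zero_le_one X)
    (by norm_num) (by norm_num) (fun _ _ => True) (fun _ A A' c' _ => rfl) (fun _ _ _ => by simp) (fun _ _ => True)
    (fun _ A A' c' _ => rfl) (fun _ _ _ => by simp) (fun _ z i _ => rfl) (by norm_num) (by norm_num) {()}
    (fun _ => [0]) (fun _ => ∅) (fun _ => 0) (fun _ _ ℓ _ A A' _ => by simp_all)
    (fun _ _ b' hb' => absurd hb' (Finset.notMem_empty _)) (fun _ _ => le_rfl) zero_le_one zero_le_one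
    (fun _ _ ℓ hℓ => by rw [List.mem_singleton.1 hℓ]; exact ContinuousLinearMap.opNorm_le_bound _ zero_le_one fun Y => by simp)
    (fun _ _ => by
      rw [List.sum_cons, List.sum_nil, add_zero]
      exact ContinuousLinearMap.opNorm_le_bound _ zero_le_one fun Y => by simp)
    (fun _ _ => by simp) ⊤ (by simp) ⊤ ⊤ ⊤ (by simp) ⊤ (fun _ f _ => AddSubgroup.mem_top _)
    (fun _ Y _ => AddSubgroup.mem_top _) (fun _ Y _ => AddSubgroup.mem_top _) (fun _ X _ => AddSubgroup.mem_top _)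
    (fun _ Z _ => AddSubgroup.mem_top _) (fun _ B _ => AddSubgroup.mem_top _) (fun _ y _ => AddSubgroup.mem_top _)
    (fun _ _ ℓ hℓ Y _ => by rw [List.mem_singleton.1 hℓ]; simp) (fun _ _ => 1) (fun _ _ _ => (unitary _).one_mem)
    (fun _ _ _ => by simp) (fun _ _ => le_rfl) le_rfl (by simp)
    le_rfl (fun _ => le_rfl) (fun _ => 0) (fun _ _ => 0)
    (fun _ f => by simp) (fun _ => ⟨fun Y _ => by simp, differentiableOn_const _⟩) one_pos le_rfl (by norm_num)
    (by norm_num) (by norm_num) (by norm_num) (by norm_num) (fun _ => 0) (fun _ B => by simp) (fun _ _ => 0)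
    (fun _ => differentiableOn_const _) (fun _ => rfl) (fun _ z _ => by simp) (by linarith) (fun _ _ => 0) le_rfl
    (fun _ Z _ => by simp) (fun _ => differentiableOn_const _) (fun _ => 0) (fun _ Y => by simp) (fun _ => 0)
    (fun _ X => by simp) (by norm_num) (by norm_num) {()} one_pos (fun _ _ => differentiableOn_const _)
    (fun _ _ Z _ => by simp) (fun _ _ => le_rfl) (fun _ => ∅) (fun _ _ A₁ A₂ _ => rfl) (fun _ => 0)
    (fun _ _ b' hb' => absurd hb' (Finset.notMem_empty _)) le_rfl (by simp) (by norm_num) (fun _ y _ => by simp)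
    (Measure.dirac ()) (fun _ => zero_le_one) (fun _ _ _ => 0) le_rfl (fun _ x _ c' _ _ => by simp)
    (fun _ x _ c' _ _ => by simp) (fun _ x _ c' _ _ ω => by simp) (fun _ y _ => by simp)
    {rdL d η} ⊤ ⊤ ⊤ (by simp) (readOutReal {readOut7 lo e})
    (fun _ f _ => ?_) (fun _ Y _ => AddSubgroup.mem_top _)
    (fun _ Y _ => AddSubgroup.mem_top _) (fun _ X' _ => ?_)
    (fun _ Z _ => AddSubgroup.mem_top _) (fun _ B hB => ?_)
    (fun _ y _ => ?_) (fun V x hx => ?_) (fun V x hxu => ?_)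
    (fun V x hJ => ?_) (fun V x t ht => ?_) (fun V x => ?_)
    (fun _ => ShellMeasureLandauHolonomyPrint.chartCube_subset_closedBall hS.le)
    (by norm_num) (by norm_num) hρ0 (by linarith) le_rfl hη (εθ₂_pos d hd1 hS hη hSη) ?_ ?_ ?_ ?_
    ha.le hrad (fun q hq => Or.inr hq) (hcore_toy lo h01 hθa) (hcollar_toy lo h01 hN ha)
  · -- `h1`: `2·B₀·C₁·B₃·ε₁ ≤ ε₄` — equality `1∕32`
    rw [show 2 * (1 / (C₄c d + 1)) * 1 * 1 * ((C₄c d + 1) / 64) = (1 : ℝ) / 32 by field_simp; ring]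
  · -- `h3`: `16·B₀·C₄·ε₄ ≤ 1` with OUR `C₄`
    rw [show 16 * (1 / (C₄c d + 1)) * C₄c d * (1 / 32) = C₄c d / (2 * (C₄c d + 1)) by field_simp; ring]
    rw [div_le_one (by positivity)]; linarith
  · -- `hH₁`: `‖(B₀∕E₀)•embOf R B‖ ≤ B₀‖B‖`
    intro V B
    rw [smul_apply, norm_smul, Complex.norm_real, Real.norm_of_nonneg (by positivity)]
    calc (1 / (C₄c d + 1)) / (6 / η) * ‖embOf d η (c₀ d) (readOut7 lo e) B‖
        ≤ (1 / (C₄c d + 1)) / (6 / η) * (2 / η * (3 * ‖B‖)) :=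
          mul_le_mul_of_nonneg_left (norm_embOf_le d hη hη1 (c₀ d) (readOut7 lo e) (by norm_num) hR7 B) (by positivity)
      _ = 1 / (C₄c d + 1) * ‖B‖ := by field_simp; ring
  · -- `hΦ`: `‖(E₀∕B₀)•z‖ < 2·dL·C₁·ε₁` on `‖z‖ < r_Φ`
    intro V z hz
    rw [mem_ball_zero_iff] at hz
    rw [norm_smul, Complex.norm_real, Real.norm_of_nonneg (by positivity)]
    calc (6 / η) / (1 / (C₄c d + 1)) * ‖z‖ < (6 / η) / (1 / (C₄c d + 1)) * (η / 192) :=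
          mul_lt_mul_of_pos_left hz (by positivity)
      _ = 2 * 1 * 1 * ((C₄c d + 1) / 64) := by field_simp; ring
  · -- `hCq`: the LIVE Landau-correction letter `Cf Z = ½·Z²` is quadratic: `‖½·Z²‖ ≤ ½‖Z‖²`
    intro V Z _
    rw [norm_smul, show ‖(1 / 2 : ℂ)‖ = 1 / 2 by simp, sq]
    exact mul_le_mul_of_nonneg_left (norm_mul_le Z Z) (by norm_num)
  · -- `hH`: `‖(B₀η∕2)•embOf c₁ id X‖ ≤ B₀‖X‖`
    intro V X'
    rw [smul_apply, norm_smul, Complex.norm_real, Real.norm_of_nonneg hs0]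
    calc 1 / (C₄c d + 1) * η / 2 * ‖embOf d η (c₁ d) (ContinuousLinearMap.id ℂ M₂) X'‖
        ≤ 1 / (C₄c d + 1) * η / 2 * (2 / η * (1 * ‖X'‖)) := mul_le_mul_of_nonneg_left
          (norm_embOf_le d hη hη1 (c₁ d) _ zero_le_one (fun y => by rw [one_mul]; exact le_rfl) X') hs0
      _ = 1 / (C₄c d + 1) * ‖X'‖ := by field_simp
  · -- `h18`: `18·C₂·B₀·ε₃ ≤ 1` — `9∕(16(C₄c d + 1)) ≤ 1`
    rw [show 18 * (1 / 2) * (1 / (C₄c d + 1)) * (1 / 16) = (9 : ℝ) / (16 * (C₄c d + 1)) by field_simp; ring]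
    rw [div_le_one (by positivity)]; linarith
  · -- `hcoup`: `ε₄ + B₀·(2dLC₁ε₁) ≤ ε₃` — equality `1∕16`
    rw [show (1 : ℝ) / 32 + 1 / (C₄c d + 1) * (2 * 1 * 1 * ((C₄c d + 1) / 64)) = 1 / 16 by field_simp; ring]
  · -- `h𝒢r`: the read-out never sees the propagator letter (`rdL ∘ 𝒢 = 0`)
    intro ℓ hℓ
    rw [Set.mem_singleton_iff.1 hℓ, rdL_𝒢L d hd01]
    exact (skewAdjoint M₂).zero_mem
  · -- `hHr`: the Landau-correction map writes at the second bond — read as `0`, skew-adjoint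
    intro ℓ hℓ
    rw [Set.mem_singleton_iff.1 hℓ, hHop0]
    exact (skewAdjoint M₂).zero_mem
  · -- `hH₁r`: the scaled embedded letter is read skew-adjoint when the chart letter is
    intro ℓ hℓ
    rw [Set.mem_singleton_iff.1 hℓ, smul_apply, map_smul, rdL_embOf_c₀]
    exact real_smul_mem_skewAdjoint (hB (readOut7 lo e) (Set.mem_singleton _)) _
  · -- `hΦr`: `Φ (cplx y)` is read skew-adjoint by leaf-03's letter
    intro ℓ hℓ
    rw [Set.mem_singleton_iff.1 hℓ, map_smul, readOut7_cplx]
    exact real_smul_mem_skewAdjoint (gen_mem_skewAdjoint _ _ _ _) _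
  · -- `hRdict`: `F(section x) = Jco V x · e^{−0}` on the cube — the three DEFINED profiles vanish on the degenerate data
    rw [toyJco7, indicator_of_mem hx]
    simp
  · -- `hudict`: leaf-03's dictionary READ THROUGH THE BLOCK SPACE — `rdL (H₁ (Φ (cplx x))) = readOut7 (cplx x) = gen x`
    have hsc : ((((1 / (C₄c d + 1)) / (6 / η) : ℝ) : ℂ) • embOf d η (c₀ d) (readOut7 lo e))
        ((((6 / η) / (1 / (C₄c d + 1)) : ℝ) : ℂ) • cplx x) = embOf d η (c₀ d) (readOut7 lo e) (cplx x) := by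
      rw [smul_apply, map_smul, smul_smul, ← Complex.ofReal_mul,
        show (1 / (C₄c d + 1)) / (6 / η) * ((6 / η) / (1 / (C₄c d + 1))) = (1 : ℝ) by field_simp, Complex.ofReal_one,
        one_smul]
    -- the minimiser correction is a GENUINE fixed point fed by OUR `blockW`, and the read-out does not see it (R10 f2)
    have hxS : ‖x‖ ≤ S :=
      mem_closedBall_zero_iff.1 (ShellMeasureLandauHolonomyPrint.chartCube_subset_closedBall hS.le hxu)
    have h𝔄 : ‖embOf d η (c₀ d) (readOut7 lo e) (cplx x)‖ < 1 / 32 :=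
      calc ‖embOf d η (c₀ d) (readOut7 lo e) (cplx x)‖ ≤ 2 / η * (3 * ‖cplx x‖) :=
            norm_embOf_le d hη hη1 (c₀ d) (readOut7 lo e) (by norm_num) hR7 _
        _ = 6 / η * ‖cplx x‖ := by ring
        _ ≤ 6 / η * S := mul_le_mul_of_nonneg_left ((norm_cplx_le x).trans hxS) (by positivity)
        _ < 6 / η * (η / 192) := mul_lt_mul_of_pos_left hSη (by positivity)
        _ = 1 / 32 := by field_simp; ring
    have hsol : rdL d η (solAt (𝒢L d η (1 / (C₄c d + 1) * η / 2)) 0 (blockW d η) (1 / 32) (0 : 𝕎 d)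
        (embOf d η (c₀ d) (readOut7 lo e) (cplx x))) = 0 :=
      rdL_solAt_eq_zero d hd01 h𝒢B (blockW_prop4Hyp d hd1 hη hη1) hB₀.le hC h𝔄 (by norm_num) (by norm_num)
        (by
          rw [show 1 / (C₄c d + 1) * C₄c d * (1 / 32 + 1 / 32) ^ 2 = C₄c d / (256 * (C₄c d + 1)) by field_simp; ring]
          rw [div_le_iff₀ (by positivity)]; nlinarith)
        (by
          rw [show 4 * (1 / (C₄c d + 1)) * C₄c d * (1 / 32 + 1 / 32) = C₄c d / (4 * (C₄c d + 1)) by field_simp; ring]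
          rw [div_lt_one (by positivity)]; linarith)
    rw [toyU, plaqHol_p₀_sec hN h01, dist1_eq_norm_coe_sub_one, coe_chart]
    simp only [classifier, Finset.sup'_singleton, holOf_apply, List.map_cons, List.map_nil, wordExp_cons, wordExp_nil,
      mul_one, ShellMeasureLandauHolonomy.landauExp, map_sub, hHop0, sub_zero, hsc, map_add, hsol, zero_add, rdL_embOf_c₀,
      readOut7_cplx]
  · -- `hJW`: `Jco` lives on the cube
    by_contra h
    exact hJ (indicator_of_notMem h _)
  · -- `hJ`: centre-monotone (leaf-03's `toyF7_section_mono`)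
    unfold toyJco7
    by_cases hx : x ∈ cube m₀ S
    · rw [indicator_of_mem hx, indicator_of_mem (smul_mem_cube hx ht)]
      exact toyF7_section_mono lo h01 hN hSπ e a V hx ht
    · rw [indicator_of_notMem hx]; exact bot_le
  · -- `hJ1`
    unfold toyJco7
    by_cases hx : x ∈ cube m₀ S
    · rw [indicator_of_mem hx]; exact toyF7_le_one lo h01 a _
    · rw [indicator_of_notMem hx]; exact bot_le
  · -- `hs₁`: curl read-out × field size — `1·z̄ ≤ (z̄∕η²)·η²·1`
    rw [hamp, show ampC d / η ^ 2 * η ^ 2 * 1 = ampC d by field_simp]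
  · -- `ha`: letter size — `1·z̄ ≤ (z̄∕η)·η·1`
    rw [hamp, show ampC d / η * η * 1 = ampC d by field_simp]
  · -- `hma`: regime `m·κ_r·z̄ ≤ 1`
    rw [hamp, Nat.cast_one, one_mul]; linarith
  · -- `hsm`: (SM) with equality by the choice of `εθ₂`
    unfold εθ₂
    rw [show (1 : ℝ) / 2 * (72 * (ampC d / η ^ 2 * 1 + ((1 : ℕ) : ℝ) ^ 2 * (ampC d / η) ^ 2 * 1 ^ 2) /
        ((η / 192) / S - 1) ^ 2) = 36 * (ampC d / η ^ 2 * 1 + ((1 : ℕ) : ℝ) ^ 2 * (ampC d / η) ^ 2 * 1 ^ 2) /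
        ((η / 192) / S - 1) ^ 2 by ring]

/-- **CLEAN FORM**: the same with the slot constant `4·m₀` (the degenerate (T2)∕(T3)∕(S78) budgets vanish). [folklore] -/
theorem slotAC_assembled_decay_core_collar_blockP4 (lo : Fin P.d → ℤ) {i₀ i₁ : Fin P.d} (h01 : i₀ < i₁)
    (h3 : 3 ≤ P.sitesPerDir j) {m₀ : ℕ} (e : ↥({b₀ lo i₀ i₁} : Finset (PBond P j)) × Fin 3 ≃ Fin m₀)
    (d : ℕ) [NeZero d] (hd2 : 2 ≤ d) {η S ρ a : ℝ} (hη : 0 < η) (hη1 : η ≤ 1) (hS : 0 < S) (hSη : S < η / 192)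
    (hρ0 : 0 ≤ ρ) (hρ4 : ρ ≤ 1 / 4) (ha : 0 < a)
    (hrad : ((P.d - 1 : ℕ) : ℝ) * (2 : ℕ) * a ≤ 2 * Real.sin (S / 2)) (hθa : εθ₂ d S η * η ^ 2 ≤ a) :
    SlotAntiConcentration ((fieldMeasure P j SU2).withDensity (toyF7 lo h01 a)) (toyU (p₀ lo i₀ i₁ h01)) (εθ₂ d S η * η ^ 2) ρ
      (4 * m₀) := by
  have h := slotAC_assembled_decay_core_collar_blockP4_lit lo h01 h3 e d hd2 hη hη1 hS hSη hρ0 hρ4 ha hrad hθa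
  convert h using 2
  simp only [abs_zero, zero_mul, mul_zero, zero_div, zero_add, add_zero]
  ring

end End

end Summit.QuantumFields.BalabanUV.T4Continuum.ShellMeasureLandauEndAssembledReachBlockP4

end
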